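import Summits.QuantumFields.BalabanUV.Beta.GAN24.DerivativeRateTransferSqueeze

/-!
# `BalabanUV.Beta.GAN24.DerivativeRateTransferLoewnerGramVariation` — binder row G-an2-4 ∕ (CONV-C), route R6 «VALUES, NOT DERIVATIVES», PART 103:
# THE EFFECTIVE-FORM TOWER IS OF BOUNDED VARIATION, ENTRYWISE AND EXPLICITLY — WITHOUT (CONS): under the (STAB-ε_j,δ_j) steps with bounded partial sums of the
# slacks and a bounded diagonal, `Σ_{j<n} |𝒮_{j+1}(a,b) − 𝒮_j(a,b)| ≤ B + 2(B·Sε + Sδ)` for every `n` — the total variation the RATE would sum to, with no rate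
# (unit b2b-balaban-gan24-p3, gen 48; v1)

NOT IN PRINT; OUR PROOF (for the ROUTE; [folklore] — PSD `2 × 2` minors `|D_{ab}| ≤ (D_{aa} + D_{bb})∕2`, telescoping; PART 20's `effForm_step_posSemidef_of_stabGram`, PART 18's
`abs_apply_le_of_diag_le`, PART 29's `posSemidef_effForm` BY NAME).  HONEST FRAMING (cell contract, verbatim): «discharging `BetaPertH` makes Bałaban's UV stability
UNCONDITIONAL — a real constructive-QFT result; it is NOT the continuum limit and NOT the Clay problem.»  HONEST DEPENDENCY (verbatim): «continuum YM on T⁴ ⇐ BetaPertH ∧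
nine spine estimates (0/9 proved); BetaPertH ⇐ (D1) ∧ (D4) ∧ CAP+tail; G-an2-4 gates asym, D1 and NE2/3/4.»

WHY THIS FILE.  PART 99 (`…LoewnerGramConverge`) shows that WITHOUT (CONS) the effective forms still converge (almost-monotone bounded sequences).  The same datum
gives more, and quantitatively: the PSD step matrices `D_j = (1+ε_j)𝒮_{j+1} + δ_jℋ_{j+1}ᵀG_{j+1}ℋ_{j+1} − 𝒮_j` (PART 20) have TELESCOPING diagonals —
`Σ_{j<n}D_j(y,y) ≤ 𝒮_n(y,y) − 𝒮_0(y,y) + B·Σε + Σδ_jN_{j+1} ≤ B + B·Sε + Sδ` — and a PSD matrix has `|D_{ab}| ≤ (D_{aa} + D_{bb})∕2`; since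
`𝒮_{j+1} − 𝒮_j = D_j − ε_j𝒮_{j+1} − δ_jℋᵀGℋ`, the increments are ABSOLUTELY SUMMABLE entrywise with the explicit total variation `B + 2(B·Sε + Sδ)`.  This is the
«bounded-variation ∕ ℓ¹» form of (CONV-C)'s existence half in the route's currency (what the lens's toys measure as «TV convergent, class (α)»), with NO (CONS) and
NO prolongation `P`; (CONS) remains the price of a geometric RATE only (PARTs 18 ∕ 20 ∕ 88 ∕ 96).

WHAT THIS FILE PROVES (0 sorry, 0 `def`, nothing cited):
* §1 `abs_apply_le_half_diag_add` (real PSD `D`: `|D a b| ≤ (D a a + D b b)∕2`).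
* §2 `diag_step_le_of_stabGram` (the diagonal of PART 20's PSD step matrix: `D_j(y,y) ≤ (𝒮_{j+1} − 𝒮_j)(y,y) + ε_jB + δ_jN_{j+1}`),
  `abs_effForm_step_le_diag_of_stabGram` (`|𝒮_{j+1}(a,b) − 𝒮_j(a,b)| ≤ (D_j(a,a) + D_j(b,b))∕2 + ε_jB + δ_jN_{j+1}`).
* §3 **`sum_abs_effForm_step_le`** — PSD `H j`, nonsingular bordered matrices, `Qc (j+1) = Qc j·Qf j`, PSD carriers, (STAB-ε_j,δ_j) with `0 ≤ ε_j, δ_j`,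
  `Σ_{i<n}ε_i ≤ Sε`, Gram letter `|(ℋ_jᵀG_jℋ_j)_{ab}| ≤ N_j` with `Σ_{i<n}δ_iN_{i+1} ≤ Sδ`, diagonal `𝒮_j(a,a) ≤ B` ⟹
  **`Σ_{j<n} |𝒮_{j+1}(a,b) − 𝒮_j(a,b)| ≤ B + 2(B·Sε + Sδ)`** for all `n, a, b`; `sum_diag_step_le` (the telescoping diagonal).
* §4 `mismatchEnergy_single_le_diag_step` (the restriction leg `Qf_jℋ_{j+1}e_y − ℋ_je_y` in coarse energy is below `D_j(y,y)`),
  **`sum_mismatchEnergy_le`** (`Σ_{j<n}⟨m_j(y), H_jm_j(y)⟩ ≤ B + (B·Sε + Sδ)` — R9°'s squeeze object is square-summable in energy WITHOUT (CONS)),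
  `sum_mismatchSq_le_of_coercive` (`Σ_{j<n}γ_j|m_j(y)|² ≤ B + (B·Sε + Sδ)` under coercivity on `ker Qc_j`).
WHAT IT DOES NOT DO: a rate; decay; the LINK-currency mismatch `τ_j` (R9° proper).  SUPPLIER work on route C-R6° (rank 2, REDUCTION); no consumer of record; NEVER «G-an2-4 closed»; NOT (CONV-C), NOT D1, NOT
`BetaPertH`, NOT continuum, NOT Clay.  Records: `HOME/b2b-balaban-gan24-p3/gen48/R6-LEDGER-NOTE.md`, `…/gen48/README.md`.
-/

noncomputable section

open Set Matrix Finset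

namespace Summit.QuantumFields.BalabanUV.Beta.GAN24.DerivativeRateTransferLoewnerGramVariation

open Literature.MathematicalPhysics.QuantumFieldTheory.Balaban1983to89.Beta.Composition (kkt)
open Literature.MathematicalPhysics.QuantumFieldTheory.Balaban1983to89.Beta.CompositionSingular (effForm minOp)
open Summit.QuantumFields.BalabanUV.Beta.GAN24.DerivativeRateTransferLoewnerKKT (abs_apply_le_of_diag_le transpose_eq_of_posSemidef energy_split
  mulVec_minOp mulVec_dotProduct_eq dotProduct_effForm_eq_energy single_dotProduct_mulVec_single)
open Summit.QuantumFields.BalabanUV.Beta.GAN24.DerivativeRateTransferLoewnerGram (effForm_step_posSemidef_of_stabGram gram_minOp_apply)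
open Summit.QuantumFields.BalabanUV.Beta.GAN24.DerivativeRateTransferSqueeze (posSemidef_effForm)

/-! ## §1 A PSD matrix: each entry is below the mean of the two diagonal entries -/

section PSD

variable {n : Type*} {D : Matrix n n ℝ}

/-- **`|D a b| ≤ (D a a + D b b)∕2` FOR A REAL PSD MATRIX** (the `2 × 2` principal minor and AM–GM). [folklore] -/
theorem abs_apply_le_half_diag_add (hD : D.PosSemidef) (a b : n) : |D a b| ≤ (D a a + D b b) / 2 := by
  have hS : (D.submatrix ![a, b] ![a, b]).PosSemidef := hD.submatrix _
  have hdet := hS.det_nonneg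
  rw [Matrix.det_fin_two] at hdet
  simp only [Matrix.submatrix_apply, Matrix.cons_val_zero, Matrix.cons_val_one] at hdet
  have hab : D a b = D b a := by simpa using hD.isHermitian.apply b a
  have ha : 0 ≤ D a a := hD.diag_nonneg
  have hb : 0 ≤ D b b := hD.diag_nonneg
  rw [← hab] at hdet
  have h2 : |D a b| ^ 2 ≤ ((D a a + D b b) / 2) ^ 2 := by
    rw [sq_abs]; nlinarith [sq_nonneg (D a a - D b b)]
  exact (pow_le_pow_iff_left₀ (abs_nonneg _) (by linarith) two_ne_zero).mp h2

end PSD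

/-! ## §2 Two levels: the diagonal of the PSD step matrix and the increment -/

section TwoLevels

variable {c ν ν' : Type*} [Fintype c] [Fintype ν] [Fintype ν'] [DecidableEq c] [DecidableEq ν] [DecidableEq ν']
variable {H : Matrix ν ν ℝ} {Q : Matrix c ν ℝ} {H' : Matrix ν' ν' ℝ} {Q' : Matrix c ν' ℝ} {Qf : Matrix ν ν' ℝ} {G : Matrix ν' ν' ℝ} {ε δ B N : ℝ}

/-- **`abs_effForm_step_le_diag_of_stabGram` — THE INCREMENT AGAINST THE STEP MATRIX's DIAGONAL** [our proof]: (STAB-ε,δ) (`0 ≤ ε, δ`), `𝒮′(y,y) ≤ B`,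
`|(ℋ′ᵀGℋ′)_{ab}| ≤ N` ⟹ with `D = (1+ε)𝒮′ + δℋ′ᵀGℋ′ − 𝒮` (PSD by PART 20): `|𝒮′(a,b) − 𝒮(a,b)| ≤ (D(a,a) + D(b,b))∕2 + εB + δN`. -/
theorem abs_effForm_step_le_diag_of_stabGram (hH : H.PosSemidef) (hH' : H'.PosSemidef) (h : IsUnit (kkt H Q).det) (h' : IsUnit (kkt H' Q').det)
    (hcomp : Q' = Q * Qf) (hG : Gᵀ = G) (hε : 0 ≤ ε) (hδ : 0 ≤ δ) (hstab : ((1 + ε) • H' + δ • G - Qfᵀ * H * Qf).PosSemidef)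
    (hB : ∀ y, effForm H' Q' y y ≤ B) (hN : ∀ a b, |((minOp H' Q')ᵀ * G * minOp H' Q') a b| ≤ N) (a b : c) :
    |effForm H' Q' a b - effForm H Q a b| ≤
      (((1 + ε) • effForm H' Q' + δ • ((minOp H' Q')ᵀ * G * minOp H' Q') - effForm H Q) a a +
        ((1 + ε) • effForm H' Q' + δ • ((minOp H' Q')ᵀ * G * minOp H' Q') - effForm H Q) b b) / 2 + ε * B + δ * N := by
  set M : Matrix c c ℝ := (minOp H' Q')ᵀ * G * minOp H' Q' with hM
  have hD := effForm_step_posSemidef_of_stabGram hH hH' h h' hcomp hG hstab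
  rw [← hM] at hD
  have hDab := abs_apply_le_half_diag_add hD a b
  simp only [Matrix.sub_apply, Matrix.add_apply, Matrix.smul_apply, smul_eq_mul] at hDab
  have hSab : |effForm H' Q' a b| ≤ B := abs_apply_le_of_diag_le (posSemidef_effForm hH' h') hB a b
  have hε' : |ε * effForm H' Q' a b| ≤ ε * B := by rw [abs_mul, abs_of_nonneg hε]; exact mul_le_mul_of_nonneg_left hSab hε
  have hδ' : |δ * M a b| ≤ δ * N := by rw [abs_mul, abs_of_nonneg hδ]; exact mul_le_mul_of_nonneg_left (hN a b) hδ
  calc |effForm H' Q' a b - effForm H Q a b|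
      = |((1 + ε) * effForm H' Q' a b + δ * M a b - effForm H Q a b) - ε * effForm H' Q' a b - δ * M a b| := by ring_nf
    _ ≤ |(1 + ε) * effForm H' Q' a b + δ * M a b - effForm H Q a b - ε * effForm H' Q' a b| + |δ * M a b| := abs_sub _ _
    _ ≤ |(1 + ε) * effForm H' Q' a b + δ * M a b - effForm H Q a b| + |ε * effForm H' Q' a b| + |δ * M a b| :=
        add_le_add (abs_sub _ _) le_rfl
    _ ≤ _ := by
        simp only [Matrix.sub_apply, Matrix.add_apply, Matrix.smul_apply, smul_eq_mul]
        linarith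

/-- **`diag_step_le_of_stabGram` — THE STEP MATRIX's DIAGONAL TELESCOPES UP TO THE SLACKS**: `D(y,y) = (𝒮′ − 𝒮)(y,y) + ε𝒮′(y,y) + δ(ℋ′ᵀGℋ′)(y,y) ≤
(𝒮′ − 𝒮)(y,y) + εB + δN` (`0 ≤ ε, δ`). [folklore] -/
theorem diag_step_le_of_stabGram (hε : 0 ≤ ε) (hδ : 0 ≤ δ) (hB : ∀ y, effForm H' Q' y y ≤ B)
    (hN : ∀ a b, |((minOp H' Q')ᵀ * G * minOp H' Q') a b| ≤ N) (y : c) :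
    ((1 + ε) • effForm H' Q' + δ • ((minOp H' Q')ᵀ * G * minOp H' Q') - effForm H Q) y y ≤
      (effForm H' Q' y y - effForm H Q y y) + ε * B + δ * N := by
  rw [Matrix.sub_apply, Matrix.add_apply, Matrix.smul_apply, Matrix.smul_apply, smul_eq_mul, smul_eq_mul]
  have h1 := mul_le_mul_of_nonneg_left (hB y) hε
  have h2 := mul_le_mul_of_nonneg_left (abs_le.mp (hN y y)).2 hδ
  linarith

/-- **`mismatchEnergy_single_le_diag_step` — THE RESTRICTION LEG IS BELOW THE STEP MATRIX's DIAGONAL** [our proof; PART 18's `energy_split` at the trial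
`Qfℋ′e_y` + (STAB-ε,δ) at `ℋ′e_y`]: `⟨Qfℋ′e_y − ℋe_y, H(Qfℋ′e_y − ℋe_y)⟩ ≤ D(y,y)`, `D = (1+ε)𝒮′ + δℋ′ᵀGℋ′ − 𝒮` — R9°'s squeeze object in ENERGY currency is
controlled by the same telescoping diagonal, with NO (CONS). -/
theorem mismatchEnergy_single_le_diag_step (hH : H.PosSemidef) (h : IsUnit (kkt H Q).det) (h' : IsUnit (kkt H' Q').det) (hcomp : Q' = Q * Qf)
    (hstab : ((1 + ε) • H' + δ • G - Qfᵀ * H * Qf).PosSemidef) (y : c) :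
    (Qf *ᵥ (minOp H' Q' *ᵥ Pi.single y 1) - minOp H Q *ᵥ Pi.single y 1) ⬝ᵥ
        (H *ᵥ (Qf *ᵥ (minOp H' Q' *ᵥ Pi.single y 1) - minOp H Q *ᵥ Pi.single y 1)) ≤
      ((1 + ε) • effForm H' Q' + δ • ((minOp H' Q')ᵀ * G * minOp H' Q') - effForm H Q) y y := by
  set u' : ν' → ℝ := minOp H' Q' *ᵥ Pi.single y 1 with hu'
  have hadm : Q *ᵥ (Qf *ᵥ u') = Pi.single y 1 := by rw [mulVec_mulVec, ← hcomp, hu']; exact mulVec_minOp h' _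
  have hsplit := energy_split (transpose_eq_of_posSemidef hH) h hadm
  rw [single_dotProduct_mulVec_single] at hsplit
  have h2 := hstab.dotProduct_mulVec_nonneg u'
  simp only [star_trivial, sub_mulVec, add_mulVec, dotProduct_sub, dotProduct_add, sub_nonneg, smul_mulVec, dotProduct_smul,
    smul_eq_mul] at h2
  have e1 : (Qf *ᵥ u') ⬝ᵥ (H *ᵥ (Qf *ᵥ u')) = u' ⬝ᵥ ((Qfᵀ * H * Qf) *ᵥ u') := by
    rw [mulVec_dotProduct_eq, mulVec_mulVec, mulVec_mulVec, Matrix.mul_assoc]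
  have e2 : effForm H' Q' y y = u' ⬝ᵥ (H' *ᵥ u') := by
    rw [hu', ← dotProduct_effForm_eq_energy h', single_dotProduct_mulVec_single]
  have e3 : ((minOp H' Q')ᵀ * G * minOp H' Q') y y = u' ⬝ᵥ (G *ᵥ u') := by rw [gram_minOp_apply, hu']
  rw [Matrix.sub_apply, Matrix.add_apply, Matrix.smul_apply, Matrix.smul_apply, smul_eq_mul, smul_eq_mul, e2, e3]
  rw [e1] at hsplit
  linarith

end TwoLevels

/-! ## §3 The tower: entrywise bounded variation, explicitly -/

section Tower

variable {c : Type*} [Fintype c] [DecidableEq c]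
variable {ι : ℕ → Type*} [∀ j, Fintype (ι j)] [∀ j, DecidableEq (ι j)]
variable {H : ∀ j, Matrix (ι j) (ι j) ℝ} {Qf : ∀ j, Matrix (ι j) (ι (j + 1)) ℝ} {Qc : ∀ j, Matrix c (ι j) ℝ}
variable {G : ∀ j, Matrix (ι j) (ι j) ℝ} {ε δ N : ℕ → ℝ} {B Sε Sδ : ℝ}

/-- **`sum_diag_step_le` — THE STEP MATRICES' DIAGONALS TELESCOPE** [our proof]: under the tower data of `sum_abs_effForm_step_le` below,
`Σ_{j<n} D_j(y,y) ≤ B + (B·Sε + Sδ)` for every `n, y` (`D_j = (1+ε_j)𝒮_{j+1} + δ_jℋ_{j+1}ᵀG_{j+1}ℋ_{j+1} − 𝒮_j`). -/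
theorem sum_diag_step_le (hH : ∀ j, (H j).PosSemidef) (hk : ∀ j, IsUnit (kkt (H j) (Qc j)).det)
    (hε0 : ∀ j, 0 ≤ ε j) (hδ0 : ∀ j, 0 ≤ δ j) (hSε : ∀ n, ∑ i ∈ range n, ε i ≤ Sε)
    (hN : ∀ j a b, |((minOp (H j) (Qc j))ᵀ * G j * minOp (H j) (Qc j)) a b| ≤ N j)
    (hSδ : ∀ n, ∑ i ∈ range n, δ i * N (i + 1) ≤ Sδ) (hB : ∀ j a, effForm (H j) (Qc j) a a ≤ B) :
    ∀ n (y : c), ∑ j ∈ range n, ((1 + ε j) • effForm (H (j + 1)) (Qc (j + 1)) +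
      δ j • ((minOp (H (j + 1)) (Qc (j + 1)))ᵀ * G (j + 1) * minOp (H (j + 1)) (Qc (j + 1))) - effForm (H j) (Qc j)) y y ≤ B + (B * Sε + Sδ) := by
  intro n y
  have hSp : ∀ j, (effForm (H j) (Qc j)).PosSemidef := fun j => posSemidef_effForm (hH j) (hk j)
  have hB0 : 0 ≤ B := ((hSp 0).diag_nonneg (i := y)).trans (hB 0 y)
  calc ∑ j ∈ range n, ((1 + ε j) • effForm (H (j + 1)) (Qc (j + 1)) +
        δ j • ((minOp (H (j + 1)) (Qc (j + 1)))ᵀ * G (j + 1) * minOp (H (j + 1)) (Qc (j + 1))) - effForm (H j) (Qc j)) y y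
      ≤ ∑ j ∈ range n, ((effForm (H (j + 1)) (Qc (j + 1)) y y - effForm (H j) (Qc j) y y) + ε j * B + δ j * N (j + 1)) :=
        Finset.sum_le_sum fun j _ => diag_step_le_of_stabGram (hε0 j) (hδ0 j) (fun y => hB (j + 1) y) (fun a b => hN (j + 1) a b) y
    _ = (effForm (H n) (Qc n) y y - effForm (H 0) (Qc 0) y y) + B * ∑ j ∈ range n, ε j + ∑ j ∈ range n, δ j * N (j + 1) := by
        rw [Finset.sum_add_distrib, Finset.sum_add_distrib, Finset.sum_range_sub (fun j => effForm (H j) (Qc j) y y), Finset.mul_sum]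
        refine congrArg₂ (· + ·) (congrArg₂ (· + ·) rfl (Finset.sum_congr rfl fun j _ => by ring)) rfl
    _ ≤ B + (B * Sε + Sδ) := by
        have h0 : 0 ≤ effForm (H 0) (Qc 0) y y := (hSp 0).diag_nonneg
        have h1 := hB n y
        have h2 := mul_le_mul_of_nonneg_left (hSε n) hB0
        have h3 := hSδ n
        linarith

/-- **`sum_abs_effForm_step_le` — THE EFFECTIVE-FORM TOWER IS OF BOUNDED VARIATION, WITHOUT (CONS)** [our proof]: PSD fine forms, nonsingular bordered
matrices, `Qc (j+1) = Qc j·Qf j`, PSD carriers; (STAB-ε_j,δ_j) with `0 ≤ ε_j, δ_j` and `Σ_{i<n}ε_i ≤ Sε`; the Gram letter `|(ℋ_jᵀG_jℋ_j)_{ab}| ≤ N_j` with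
`Σ_{i<n}δ_iN_{i+1} ≤ Sδ`; the diagonal `𝒮_j(a,a) ≤ B` ⟹ **`Σ_{j<n} |𝒮_{j+1}(a,b) − 𝒮_j(a,b)| ≤ B + 2(B·Sε + Sδ)`** for all `n, a, b` — no (CONS), no `P`. -/
theorem sum_abs_effForm_step_le (hH : ∀ j, (H j).PosSemidef) (hk : ∀ j, IsUnit (kkt (H j) (Qc j)).det)
    (hcomp : ∀ j, Qc (j + 1) = Qc j * Qf j) (hGp : ∀ j, (G j).PosSemidef) (hε0 : ∀ j, 0 ≤ ε j) (hδ0 : ∀ j, 0 ≤ δ j)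
    (hstab : ∀ j, ((1 + ε j) • H (j + 1) + δ j • G (j + 1) - (Qf j)ᵀ * H j * Qf j).PosSemidef)
    (hSε : ∀ n, ∑ i ∈ range n, ε i ≤ Sε)
    (hN : ∀ j a b, |((minOp (H j) (Qc j))ᵀ * G j * minOp (H j) (Qc j)) a b| ≤ N j)
    (hSδ : ∀ n, ∑ i ∈ range n, δ i * N (i + 1) ≤ Sδ) (hB : ∀ j a, effForm (H j) (Qc j) a a ≤ B) :
    ∀ n (a b : c), ∑ j ∈ range n, |effForm (H (j + 1)) (Qc (j + 1)) a b - effForm (H j) (Qc j) a b| ≤ B + 2 * (B * Sε + Sδ) := by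
  intro n a b
  have hSp : ∀ j, (effForm (H j) (Qc j)).PosSemidef := fun j => posSemidef_effForm (hH j) (hk j)
  have hB0 : 0 ≤ B := ((hSp 0).diag_nonneg (i := a)).trans (hB 0 a)
  -- the telescoping bound of the step matrices' diagonals
  have hdiag := sum_diag_step_le (G := G) hH hk hε0 hδ0 hSε hN hSδ hB n
  -- per step
  have hstep : ∀ j, |effForm (H (j + 1)) (Qc (j + 1)) a b - effForm (H j) (Qc j) a b| ≤
      (((1 + ε j) • effForm (H (j + 1)) (Qc (j + 1)) + δ j • ((minOp (H (j + 1)) (Qc (j + 1)))ᵀ * G (j + 1) * minOp (H (j + 1)) (Qc (j + 1))) -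
          effForm (H j) (Qc j)) a a +
        ((1 + ε j) • effForm (H (j + 1)) (Qc (j + 1)) + δ j • ((minOp (H (j + 1)) (Qc (j + 1)))ᵀ * G (j + 1) * minOp (H (j + 1)) (Qc (j + 1))) -
          effForm (H j) (Qc j)) b b) / 2 + ε j * B + δ j * N (j + 1) := fun j =>
    abs_effForm_step_le_diag_of_stabGram (hH j) (hH (j + 1)) (hk j) (hk (j + 1)) (hcomp j) (transpose_eq_of_posSemidef (hGp (j + 1)))
      (hε0 j) (hδ0 j) (hstab j) (fun y => hB (j + 1) y) (fun a b => hN (j + 1) a b) a b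
  calc ∑ j ∈ range n, |effForm (H (j + 1)) (Qc (j + 1)) a b - effForm (H j) (Qc j) a b|
      ≤ ∑ j ∈ range n, ((((1 + ε j) • effForm (H (j + 1)) (Qc (j + 1)) +
            δ j • ((minOp (H (j + 1)) (Qc (j + 1)))ᵀ * G (j + 1) * minOp (H (j + 1)) (Qc (j + 1))) - effForm (H j) (Qc j)) a a +
          ((1 + ε j) • effForm (H (j + 1)) (Qc (j + 1)) +
            δ j • ((minOp (H (j + 1)) (Qc (j + 1)))ᵀ * G (j + 1) * minOp (H (j + 1)) (Qc (j + 1))) - effForm (H j) (Qc j)) b b) / 2 +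
          ε j * B + δ j * N (j + 1)) := Finset.sum_le_sum fun j _ => hstep j
    _ = (∑ j ∈ range n, ((1 + ε j) • effForm (H (j + 1)) (Qc (j + 1)) +
            δ j • ((minOp (H (j + 1)) (Qc (j + 1)))ᵀ * G (j + 1) * minOp (H (j + 1)) (Qc (j + 1))) - effForm (H j) (Qc j)) a a +
          ∑ j ∈ range n, ((1 + ε j) • effForm (H (j + 1)) (Qc (j + 1)) +
            δ j • ((minOp (H (j + 1)) (Qc (j + 1)))ᵀ * G (j + 1) * minOp (H (j + 1)) (Qc (j + 1))) - effForm (H j) (Qc j)) b b) / 2 +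
          B * ∑ j ∈ range n, ε j + ∑ j ∈ range n, δ j * N (j + 1) := by
        rw [Finset.sum_add_distrib, Finset.sum_add_distrib, ← Finset.sum_div, Finset.sum_add_distrib, Finset.mul_sum]
        refine congrArg₂ (· + ·) (congrArg₂ (· + ·) rfl (Finset.sum_congr rfl fun j _ => by ring)) rfl
    _ ≤ ((B + (B * Sε + Sδ)) + (B + (B * Sε + Sδ))) / 2 + B * Sε + Sδ := by
        have h2 := mul_le_mul_of_nonneg_left (hSε n) hB0
        linarith [hdiag a, hdiag b, hSδ n]
    _ = B + 2 * (B * Sε + Sδ) := by ring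


/-- **`sum_mismatchEnergy_le` — THE RESTRICTION LEGS ARE SUMMABLE IN ENERGY, WITHOUT (CONS)** [our proof]: under the same tower data,
`Σ_{j<n} ⟨Qf_jℋ_{j+1}e_y − ℋ_je_y, H_j(Qf_jℋ_{j+1}e_y − ℋ_je_y)⟩ ≤ B + (B·Sε + Sδ)` for every `n, y` — R9°'s squeeze object (the tower's
averaged-minimiser mismatch) is square-summable in the coarse energy norms along the tower from (STAB-ε_j,δ_j) + a bounded diagonal ALONE. -/
theorem sum_mismatchEnergy_le (hH : ∀ j, (H j).PosSemidef) (hk : ∀ j, IsUnit (kkt (H j) (Qc j)).det)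
    (hcomp : ∀ j, Qc (j + 1) = Qc j * Qf j) (hε0 : ∀ j, 0 ≤ ε j) (hδ0 : ∀ j, 0 ≤ δ j)
    (hstab : ∀ j, ((1 + ε j) • H (j + 1) + δ j • G (j + 1) - (Qf j)ᵀ * H j * Qf j).PosSemidef)
    (hSε : ∀ n, ∑ i ∈ range n, ε i ≤ Sε)
    (hN : ∀ j a b, |((minOp (H j) (Qc j))ᵀ * G j * minOp (H j) (Qc j)) a b| ≤ N j)
    (hSδ : ∀ n, ∑ i ∈ range n, δ i * N (i + 1) ≤ Sδ) (hB : ∀ j a, effForm (H j) (Qc j) a a ≤ B) :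
    ∀ n (y : c), ∑ j ∈ range n, (Qf j *ᵥ (minOp (H (j + 1)) (Qc (j + 1)) *ᵥ Pi.single y 1) - minOp (H j) (Qc j) *ᵥ Pi.single y 1) ⬝ᵥ
        (H j *ᵥ (Qf j *ᵥ (minOp (H (j + 1)) (Qc (j + 1)) *ᵥ Pi.single y 1) - minOp (H j) (Qc j) *ᵥ Pi.single y 1)) ≤ B + (B * Sε + Sδ) :=
  fun n y => (Finset.sum_le_sum fun j _ => mismatchEnergy_single_le_diag_step (hH j) (hk j) (hk (j + 1)) (hcomp j) (hstab j) y).trans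
    (sum_diag_step_le hH hk hε0 hδ0 hSε hN hSδ hB n y)

/-- **`sum_mismatchSq_le_of_coercive` — AND IN `ℓ²` MASS UNDER COERCIVITY** [our proof]: with coercivity `γ_j|z|² ≤ ⟨z,H_jz⟩` on `ker Qc_j` (`γ_j > 0`;
the mismatch IS a fluctuation): `Σ_{j<n} γ_j·|Qf_jℋ_{j+1}e_y − ℋ_je_y|² ≤ B + (B·Sε + Sδ)`. -/
theorem sum_mismatchSq_le_of_coercive (hH : ∀ j, (H j).PosSemidef) (hk : ∀ j, IsUnit (kkt (H j) (Qc j)).det)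
    (hcomp : ∀ j, Qc (j + 1) = Qc j * Qf j) (hε0 : ∀ j, 0 ≤ ε j) (hδ0 : ∀ j, 0 ≤ δ j)
    (hstab : ∀ j, ((1 + ε j) • H (j + 1) + δ j • G (j + 1) - (Qf j)ᵀ * H j * Qf j).PosSemidef)
    (hSε : ∀ n, ∑ i ∈ range n, ε i ≤ Sε)
    (hN : ∀ j a b, |((minOp (H j) (Qc j))ᵀ * G j * minOp (H j) (Qc j)) a b| ≤ N j)
    (hSδ : ∀ n, ∑ i ∈ range n, δ i * N (i + 1) ≤ Sδ) (hB : ∀ j a, effForm (H j) (Qc j) a a ≤ B)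
    {γ : ℕ → ℝ} (hcoer : ∀ j (z : ι j → ℝ), Qc j *ᵥ z = 0 → γ j * (z ⬝ᵥ z) ≤ z ⬝ᵥ (H j *ᵥ z)) :
    ∀ n (y : c), ∑ j ∈ range n, γ j * ((Qf j *ᵥ (minOp (H (j + 1)) (Qc (j + 1)) *ᵥ Pi.single y 1) - minOp (H j) (Qc j) *ᵥ Pi.single y 1) ⬝ᵥ
        (Qf j *ᵥ (minOp (H (j + 1)) (Qc (j + 1)) *ᵥ Pi.single y 1) - minOp (H j) (Qc j) *ᵥ Pi.single y 1)) ≤ B + (B * Sε + Sδ) := by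
  intro n y
  have hker : ∀ j, Qc j *ᵥ (Qf j *ᵥ (minOp (H (j + 1)) (Qc (j + 1)) *ᵥ Pi.single y 1) - minOp (H j) (Qc j) *ᵥ Pi.single y 1) = 0 := fun j => by
    rw [mulVec_sub, mulVec_mulVec, ← hcomp j, mulVec_minOp (hk (j + 1)), mulVec_minOp (hk j), sub_self]
  exact (Finset.sum_le_sum fun j _ => hcoer j _ (hker j)).trans (sum_mismatchEnergy_le hH hk hcomp hε0 hδ0 hstab hSε hN hSδ hB n y)

end Tower

end Summit.QuantumFields.BalabanUV.Beta.GAN24.DerivativeRateTransferLoewnerGramVariation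

end
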